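import Literature.Topology.FourManifolds.ToricBlowupPolar
import Literature.Geometry.Manifold.LocalDiffeoOnOpen
import HarnessLib

/-!
# Local-model pieces of a surface tube in plumbing coordinates (generic form)

Topic `Literature/Topology/FourManifolds` (fact seat of the Seiberg–Witten leaf
`Literature.Barriers.SmoothPoincare4.akhmedovPark2010_lemma8_invariants`; block 2 of
Akhmedov–Park's `X₁(m)`, A. Akhmedov, B. D. Park, Invent. Math. 181 (2010), §3).  The tube of the
genus-2 surface `Σ̄₂ ⊂ T⁴ # ℂℙ²bar` is assembled from product tubes and two LOCAL MODELS, maps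
`M : ℂ × ℂ → ℂ × ℂ` that are `C^∞`, injective and have invertible strict derivatives on an open
set `U` (the resolution neck of `DoublePointResolutionNeck.lean` on `{v ≠ 0} × B(0, δ)`, the
blow-up cap of `BlowUpLineCapTube.lean` on `{‖a‖ < 3/4} × {‖ν‖ < 1/2}`), transported into the
ambient `4`-manifold `Y` by a chart `Q : Y → ℝ⁴ ≅ ℂ × ℂ` with full target (a plumbing chart of
`T⁴`, `SurfaceTimesTorusPlumbingChart.lean`, or an affine chart of `ℂℙ²`) and parametrised by a
surface chart `eF` (`A = eF` as a complex number) and a linear fibre coordinate: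

  `Mk (p, ṽ) = Q⁻¹ (fromC2 (M (A p, k ṽ)))`  on  `D = {(p, ṽ) | p ∈ eF.source, (A p, k ṽ) ∈ U}`.

This file proves, with the properties of `M`, `Q`, `eF` as hypotheses (so that it is independent of
the particular models): `Mk` is smooth on `D` (`contMDiffOn_modelPiece`), injective on `D`
(`injOn_modelPiece`), maps open subsets of `D` to open sets (`isOpen_image_modelPiece`, inverse
function theorem, `LocalDiffeoOnOpen.lean`) and has a left inverse smooth on `Mk '' D`
(`exists_inverse_modelPiece`); and the coordinate identity `toC2 (Q (Mk (p, ṽ))) = M (A p, k ṽ)`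
(`toC2_modelPiece`) through which the zone formulas of the models are read off.  Everything is
proved; no definitions (maps bound by hypotheses).

## References

* A. Akhmedov, B. D. Park, Invent. Math. 181 (2010) 577–603 = arXiv:math/0701829, §3. [AkhmedovPark2010]
* J. M. Lee, *Introduction to Smooth Manifolds*, 2nd ed. (2013), Thm. 4.5, Prop. 5.2. [LeeSmoothManifolds2013]
-/

noncomputable section

open scoped Manifold ContDiff Topology
open Set Function Complex
open Literature.Topology.FourManifolds.ToricBlowup

namespace Literature.Topology.FourManifolds

namespace ModelPiece

/-! ### §0 The linear identification `ℝ² ≅ ℂ`, `v ↦ v₀ + i v₁` -/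

/-- Smoothness of `v ↦ v₀ + i v₁`. [folklore] -/
theorem contMDiff_toComplex :
    ContMDiff (𝓡 2) 𝓘(ℝ, ℂ) ∞ fun v : EuclideanSpace ℝ (Fin 2) => (⟨v 0, v 1⟩ : ℂ) := by
  have h0 : ContMDiff (𝓡 2) 𝓘(ℝ, ℝ) ∞ (fun v : EuclideanSpace ℝ (Fin 2) => v 0) :=
    (EuclideanSpace.proj (𝕜 := ℝ) (ι := Fin 2) 0).contMDiff
  have h1 : ContMDiff (𝓡 2) 𝓘(ℝ, ℝ) ∞ (fun v : EuclideanSpace ℝ (Fin 2) => v 1) :=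
    (EuclideanSpace.proj (𝕜 := ℝ) (ι := Fin 2) 1).contMDiff
  exact Complex.equivRealProdCLM.symm.contDiff.comp_contMDiff (h0.prodMk_space h1)

/-- Smoothness of the inverse identification `z ↦ (Re z, Im z)`. [folklore] -/
theorem contMDiff_ofComplex :
    ContMDiff 𝓘(ℝ, ℂ) (𝓡 2) ∞ fun z : ℂ =>
      z.re • EuclideanSpace.single (0 : Fin 2) (1 : ℝ) + z.im • EuclideanSpace.single (1 : Fin 2) (1 : ℝ) :=
  (Complex.reCLM.contMDiff.smul contMDiff_const).add (Complex.imCLM.contMDiff.smul contMDiff_const)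

/-- The two identifications are inverse to each other, `v ↦ v₀ + i v₁` is norm preserving and
commutes with real scalings. [folklore] -/
theorem toComplex_basic :
    (∀ z : ℂ, (⟨(z.re • EuclideanSpace.single (0 : Fin 2) (1 : ℝ) +
        z.im • EuclideanSpace.single (1 : Fin 2) (1 : ℝ)) 0,
      (z.re • EuclideanSpace.single (0 : Fin 2) (1 : ℝ) +
        z.im • EuclideanSpace.single (1 : Fin 2) (1 : ℝ)) 1⟩ : ℂ) = z) ∧
    (∀ v : EuclideanSpace ℝ (Fin 2), (⟨v 0, v 1⟩ : ℂ).re • EuclideanSpace.single (0 : Fin 2) (1 : ℝ) +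
        (⟨v 0, v 1⟩ : ℂ).im • EuclideanSpace.single (1 : Fin 2) (1 : ℝ) = v) ∧
    (∀ v : EuclideanSpace ℝ (Fin 2), ‖(⟨v 0, v 1⟩ : ℂ)‖ = ‖v‖) ∧
    (∀ (r : ℝ) (v : EuclideanSpace ℝ (Fin 2)), (⟨(r • v) 0, (r • v) 1⟩ : ℂ) = (r : ℂ) * ⟨v 0, v 1⟩) := by
  refine ⟨fun z => ?_, fun v => ?_, fun v => ?_, fun r v => ?_⟩
  · apply Complex.ext <;> simp
  · ext i
    fin_cases i <;> simp
  · rw [EuclideanSpace.norm_eq, Complex.norm_def, Complex.normSq_apply]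
    congr 1
    simp [Fin.sum_univ_two, sq]
  · apply Complex.ext <;> simp

/-! ### §1 The piece -/

section Piece

variable {F : Type} [TopologicalSpace F] [ChartedSpace (EuclideanSpace ℝ (Fin 2)) F]
  {Y : Type} [TopologicalSpace Y] [ChartedSpace (EuclideanSpace ℝ (Fin 4)) Y]
  {eF : OpenPartialHomeomorph F (EuclideanSpace ℝ (Fin 2))} {A : F → ℂ}
  {Q : OpenPartialHomeomorph Y (EuclideanSpace ℝ (Fin 4))}
  {M : ℂ × ℂ → ℂ × ℂ} {U : Set (ℂ × ℂ)} {k : ℝ}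
  {Mk : F × EuclideanSpace ℝ (Fin 2) → Y}

variable (heF : eF ∈ IsManifold.maximalAtlas (𝓡 2) ∞ F) (heFt : eF.target = univ)
  (hA : ∀ p, A p = ⟨eF p 0, eF p 1⟩)
  (hQ : Q ∈ IsManifold.maximalAtlas (𝓡 4) ∞ Y) (hQt : Q.target = univ)
  (hU : IsOpen U) (hM1 : ContDiffOn ℝ ∞ M U) (hM4 : InjOn M U)
  (hM5 : ∀ q ∈ U, ∃ L : (ℂ × ℂ) ≃L[ℝ] (ℂ × ℂ), HasStrictFDerivAt M (L : ℂ × ℂ →L[ℝ] ℂ × ℂ) q)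
  (hk : 0 < k)
  (hMk : ∀ (p : F) (w : EuclideanSpace ℝ (Fin 2)),
    Mk (p, w) = Q.symm (fromC2 (M (A p, (k : ℂ) * ⟨w 0, w 1⟩))))

omit [ChartedSpace (EuclideanSpace ℝ (Fin 4)) Y] in
include hQt in
/-- `Q (Q⁻¹ y) = y` and `Q⁻¹ y ∈ Q.source` for every `y` (full target). [folklore] -/
theorem apply_symm (y : EuclideanSpace ℝ (Fin 4)) : Q (Q.symm y) = y ∧ Q.symm y ∈ Q.source := by
  have hy : y ∈ Q.target := by rw [hQt]; exact mem_univ y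
  exact ⟨Q.right_inv hy, Q.map_target hy⟩

omit [ChartedSpace (EuclideanSpace ℝ (Fin 2)) F] in
include hA in
/-- `A` is injective on the chart domain, with inverse `eF⁻¹ (Re A, Im A)`. [folklore] -/
theorem injOn_A : InjOn A eF.source ∧ ∀ p ∈ eF.source,
    eF.symm ((A p).re • EuclideanSpace.single (0 : Fin 2) (1 : ℝ) +
      (A p).im • EuclideanSpace.single (1 : Fin 2) (1 : ℝ)) = p := by
  obtain ⟨-, h2, -, -⟩ := toComplex_basic
  constructor
  · intro p hp q hq h
    have h' := congrArg (fun z : ℂ => z.re • EuclideanSpace.single (0 : Fin 2) (1 : ℝ) +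
      z.im • EuclideanSpace.single (1 : Fin 2) (1 : ℝ)) h
    simp only [hA, h2] at h'
    exact eF.injOn hp hq h'
  · intro p hp
    rw [hA, h2, eF.left_inv hp]

omit [TopologicalSpace F] [ChartedSpace (EuclideanSpace ℝ (Fin 2)) F]
  [ChartedSpace (EuclideanSpace ℝ (Fin 4)) Y] in
include hQt hMk in
/-- The defining identity in coordinates: `toC2 (Q (Mk (p, ṽ))) = M (A p, k ṽ)`, and
`Mk (p, ṽ) ∈ Q.source`. [folklore] -/
theorem toC2_modelPiece (p : F) (w : EuclideanSpace ℝ (Fin 2)) :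
    toC2 (Q (Mk (p, w))) = M (A p, (k : ℂ) * ⟨w 0, w 1⟩) ∧ Mk (p, w) ∈ Q.source := by
  obtain ⟨h1, h2⟩ := apply_symm hQt (fromC2 (M (A p, (k : ℂ) * ⟨w 0, w 1⟩)))
  rw [hMk, h1, toC2_fromC2]
  exact ⟨rfl, h2⟩

include heF hA hQ hQt hM1 hMk in
/-- **The piece is smooth** on `D = {(p, ṽ) | p ∈ eF.source, (A p, k ṽ) ∈ U}`.
[cite: AkhmedovPark2010, §3] -/
theorem contMDiffOn_modelPiece :
    ContMDiffOn ((𝓡 2).prod (𝓡 2)) (𝓡 4) ∞ Mk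
      {q | q.1 ∈ eF.source ∧ (A q.1, (k : ℂ) * ⟨q.2 0, q.2 1⟩) ∈ U} := by
  have hAsm : ContMDiffOn (𝓡 2) 𝓘(ℝ, ℂ) ∞ A eF.source := by
    have : A = (fun v : EuclideanSpace ℝ (Fin 2) => (⟨v 0, v 1⟩ : ℂ)) ∘ eF := funext fun p => hA p
    rw [this]
    exact contMDiff_toComplex.comp_contMDiffOn (contMDiffOn_of_mem_maximalAtlas heF)
  have hmulk : ContDiff ℝ ∞ fun z : ℂ => (k : ℂ) * z := contDiff_const.mul contDiff_id
  have hΛ : ContMDiffOn ((𝓡 2).prod (𝓡 2)) 𝓘(ℝ, ℂ × ℂ) ∞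
      (fun q : F × EuclideanSpace ℝ (Fin 2) => (A q.1, (k : ℂ) * ⟨q.2 0, q.2 1⟩))
      {q | q.1 ∈ eF.source ∧ (A q.1, (k : ℂ) * ⟨q.2 0, q.2 1⟩) ∈ U} := by
    refine ContMDiffOn.prodMk_space ?_ ?_
    · exact hAsm.comp contMDiff_fst.contMDiffOn fun q hq => hq.1
    · exact (hmulk.comp_contMDiff (contMDiff_toComplex.comp contMDiff_snd)).contMDiffOn
  have hMΛ : ContMDiffOn ((𝓡 2).prod (𝓡 2)) 𝓘(ℝ, ℂ × ℂ) ∞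
      (fun q : F × EuclideanSpace ℝ (Fin 2) => M (A q.1, (k : ℂ) * ⟨q.2 0, q.2 1⟩))
      {q | q.1 ∈ eF.source ∧ (A q.1, (k : ℂ) * ⟨q.2 0, q.2 1⟩) ∈ U} :=
    hM1.contMDiffOn.comp hΛ fun q hq => hq.2
  have hfrom : ContMDiff 𝓘(ℝ, ℂ × ℂ) (𝓡 4) ∞ fromC2 := contDiff_fromC2.contMDiff
  have hsymm : ContMDiffOn (𝓡 4) (𝓡 4) ∞ Q.symm univ := by
    rw [← hQt]; exact contMDiffOn_symm_of_mem_maximalAtlas hQ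
  have heq : Mk = fun q : F × EuclideanSpace ℝ (Fin 2) =>
      Q.symm (fromC2 (M (A q.1, (k : ℂ) * ⟨q.2 0, q.2 1⟩))) := funext fun ⟨p, w⟩ => hMk p w
  rw [heq]
  exact hsymm.comp (hfrom.comp_contMDiffOn hMΛ) fun _ _ => mem_univ _

omit [ChartedSpace (EuclideanSpace ℝ (Fin 2)) F] [ChartedSpace (EuclideanSpace ℝ (Fin 4)) Y] in
include hA hQt hM4 hk hMk in
/-- **The piece is injective** on `D`. [cite: AkhmedovPark2010, §3] -/
theorem injOn_modelPiece :
    InjOn Mk {q | q.1 ∈ eF.source ∧ (A q.1, (k : ℂ) * ⟨q.2 0, q.2 1⟩) ∈ U} := by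
  obtain ⟨-, h2, -, -⟩ := toComplex_basic
  rintro ⟨p, w⟩ ⟨hp, hpU⟩ ⟨p', w'⟩ ⟨hp', hpU'⟩ h
  have h1 := congrArg (fun x => toC2 (Q x)) h
  simp only at hp hp' hpU hpU'
  rw [(toC2_modelPiece hQt hMk p w).1, (toC2_modelPiece hQt hMk p' w').1] at h1
  obtain ⟨hAA, hww⟩ := Prod.mk.inj (hM4 hpU hpU' h1)
  have hpp : p = p' := (injOn_A hA).1 hp hp' hAA
  have hww' : w = w' := by
    have h3 : (⟨w 0, w 1⟩ : ℂ) = ⟨w' 0, w' 1⟩ := mul_left_cancel₀ (Complex.ofReal_ne_zero.2 hk.ne') hww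
    rw [← h2 w, ← h2 w', h3]
  rw [hpp, hww']

omit [ChartedSpace (EuclideanSpace ℝ (Fin 2)) F] [ChartedSpace (EuclideanSpace ℝ (Fin 4)) Y] in
include hA hQt hM5 hk hMk in
/-- **The piece is open**: images of open subsets of `D` are open (chart, linear isomorphisms and
the inverse function theorem for `M`). [cite: LeeSmoothManifolds2013, Prop. 4.22] -/
theorem isOpen_image_modelPiece {W : Set (F × EuclideanSpace ℝ (Fin 2))} (hWo : IsOpen W)
    (hW : W ⊆ {q | q.1 ∈ eF.source ∧ (A q.1, (k : ℂ) * ⟨q.2 0, q.2 1⟩) ∈ U}) :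
    IsOpen (Mk '' W) := by
  obtain ⟨h1b, h2b, -, h4b⟩ := toComplex_basic
  let Hk : EuclideanSpace ℝ (Fin 2) ≃ₜ EuclideanSpace ℝ (Fin 2) := Homeomorph.smulOfNeZero k hk.ne'
  let EK : OpenPartialHomeomorph (F × EuclideanSpace ℝ (Fin 2))
      (EuclideanSpace ℝ (Fin 2) × EuclideanSpace ℝ (Fin 2)) := eF.prod Hk.toOpenPartialHomeomorph
  let CC : (EuclideanSpace ℝ (Fin 2) × EuclideanSpace ℝ (Fin 2)) ≃ₜ ℂ × ℂ :=
    { toFun := fun q => ((⟨q.1 0, q.1 1⟩ : ℂ), (⟨q.2 0, q.2 1⟩ : ℂ))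
      invFun := fun q => (q.1.re • EuclideanSpace.single (0 : Fin 2) (1 : ℝ) +
          q.1.im • EuclideanSpace.single (1 : Fin 2) (1 : ℝ),
        q.2.re • EuclideanSpace.single (0 : Fin 2) (1 : ℝ) +
          q.2.im • EuclideanSpace.single (1 : Fin 2) (1 : ℝ))
      left_inv := fun q => by simp only [h2b]
      right_inv := fun q => by simp only [h1b]
      continuous_toFun := (contMDiff_toComplex.continuous.comp continuous_fst).prodMk
        (contMDiff_toComplex.continuous.comp continuous_snd)
      continuous_invFun := (contMDiff_ofComplex.continuous.comp continuous_fst).prodMk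
        (contMDiff_ofComplex.continuous.comp continuous_snd) }
  let FC : ℂ × ℂ ≃ₜ EuclideanSpace ℝ (Fin 4) :=
    { toFun := fromC2
      invFun := toC2
      left_inv := toC2_fromC2
      right_inv := fromC2_toC2
      continuous_toFun := contDiff_fromC2.continuous
      continuous_invFun := contDiff_toC2.continuous }
  have hfac : ∀ q : F × EuclideanSpace ℝ (Fin 2), Mk q = Q.symm (FC (M (CC (EK q)))) := by
    rintro ⟨p, w⟩
    rw [hMk]
    show Q.symm (fromC2 (M (A p, (k : ℂ) * ⟨w 0, w 1⟩))) =
      Q.symm (fromC2 (M ((⟨eF p 0, eF p 1⟩ : ℂ), (⟨(k • w) 0, (k • w) 1⟩ : ℂ))))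
    rw [hA, h4b]
  have himage : Mk '' W = Q.symm '' (FC '' (M '' (CC '' (EK '' W)))) := by
    ext x
    simp only [mem_image]
    constructor
    · rintro ⟨q, hq, rfl⟩
      exact ⟨_, ⟨_, ⟨_, ⟨_, ⟨q, hq, rfl⟩, rfl⟩, rfl⟩, rfl⟩, (hfac q).symm⟩
    · rintro ⟨_, ⟨_, ⟨_, ⟨_, ⟨q, hq, rfl⟩, rfl⟩, rfl⟩, rfl⟩, rfl⟩
      exact ⟨q, hq, hfac q⟩
  rw [himage]
  have hWs : W ⊆ EK.source := by
    intro q hq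
    show q ∈ eF.source ×ˢ (univ : Set (EuclideanSpace ℝ (Fin 2)))
    exact ⟨(hW hq).1, mem_univ _⟩
  have h1 : IsOpen (EK '' W) := EK.isOpen_image_of_subset_source hWo hWs
  have h2 : IsOpen (CC '' (EK '' W)) := CC.isOpenMap _ h1
  have h3 : IsOpen (M '' (CC '' (EK '' W))) := by
    refine Literature.Geometry.Manifold.isOpen_image_of_subset_of_forall_hasStrictFDerivAt_equiv
      (U := U) hM5 h2 ?_
    rintro _ ⟨_, ⟨⟨p, w⟩, hq, rfl⟩, rfl⟩
    obtain ⟨-, hpU⟩ := hW hq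
    show ((⟨eF p 0, eF p 1⟩ : ℂ), (⟨(k • w) 0, (k • w) 1⟩ : ℂ)) ∈ U
    rwa [h4b, ← hA]
  have h4 : IsOpen (FC '' (M '' (CC '' (EK '' W)))) := FC.isOpenMap _ h3
  refine Q.symm.isOpen_image_of_subset_source h4 ?_
  intro y _
  show y ∈ Q.target
  rw [hQt]; exact mem_univ y

include heF heFt hA hQ hQt hU hM1 hM4 hM5 hk hMk in
/-- **A left inverse of the piece, smooth on its image** (the inverse of `M` on `M '' U` is smooth
by the inverse function theorem, `contDiffOn_invFunOn_of_forall_hasStrictFDerivAt_equiv`).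
[cite: LeeSmoothManifolds2013, Thm. 4.5] -/
theorem exists_inverse_modelPiece :
    ∃ Minv : Y → F × EuclideanSpace ℝ (Fin 2),
      ContMDiffOn (𝓡 4) ((𝓡 2).prod (𝓡 2)) ∞ Minv
        (Mk '' {q | q.1 ∈ eF.source ∧ (A q.1, (k : ℂ) * ⟨q.2 0, q.2 1⟩) ∈ U}) ∧
      ∀ q ∈ {q : F × EuclideanSpace ℝ (Fin 2) | q.1 ∈ eF.source ∧ (A q.1, (k : ℂ) * ⟨q.2 0, q.2 1⟩) ∈ U},
        Minv (Mk q) = q := by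
  obtain ⟨h1b, h2b, -, h4b⟩ := toComplex_basic
  let invM : ℂ × ℂ → ℂ × ℂ := invFunOn M U
  have hinvM : ContDiffOn ℝ ∞ invM (M '' U) :=
    Literature.Geometry.Manifold.contDiffOn_invFunOn_of_forall_hasStrictFDerivAt_equiv hU hM1
      (by simp) hM4 hM5
  have hleftM : ∀ q ∈ U, invM (M q) = q := fun q hq => hM4.leftInvOn_invFunOn hq
  let vc : ℂ → EuclideanSpace ℝ (Fin 2) := fun z =>
    z.re • EuclideanSpace.single (0 : Fin 2) (1 : ℝ) + z.im • EuclideanSpace.single (1 : Fin 2) (1 : ℝ)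
  let Minv : Y → F × EuclideanSpace ℝ (Fin 2) := fun x =>
    (eF.symm (vc (invM (toC2 (Q x))).1), k⁻¹ • vc (invM (toC2 (Q x))).2)
  set D : Set (F × EuclideanSpace ℝ (Fin 2)) :=
    {q | q.1 ∈ eF.source ∧ (A q.1, (k : ℂ) * ⟨q.2 0, q.2 1⟩) ∈ U} with hD
  refine ⟨Minv, ?_, ?_⟩
  · have hQsm : ContMDiffOn (𝓡 4) (𝓡 4) ∞ Q Q.source := contMDiffOn_of_mem_maximalAtlas hQ
    have himg : ∀ x ∈ Mk '' D, x ∈ Q.source ∧ toC2 (Q x) ∈ M '' U := by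
      rintro _ ⟨⟨p, w⟩, hq, rfl⟩
      obtain ⟨h1, h2⟩ := toC2_modelPiece hQt hMk p w
      exact ⟨h2, by rw [h1]; exact ⟨_, hq.2, rfl⟩⟩
    have hG : ContMDiffOn (𝓡 4) 𝓘(ℝ, ℂ × ℂ) ∞ (fun x => invM (toC2 (Q x))) (Mk '' D) := by
      refine hinvM.contMDiffOn.comp ((contDiff_toC2.contMDiff.comp_contMDiffOn
        (hQsm.mono fun x hx => (himg x hx).1))) fun x hx => (himg x hx).2
    have hG1 : ContMDiffOn (𝓡 4) 𝓘(ℝ, ℂ) ∞ (fun x => (invM (toC2 (Q x))).1) (Mk '' D) :=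
      fun x hx => contDiff_fst.contDiffAt.comp_contMDiffWithinAt (hG x hx)
    have hG2 : ContMDiffOn (𝓡 4) 𝓘(ℝ, ℂ) ∞ (fun x => (invM (toC2 (Q x))).2) (Mk '' D) :=
      fun x hx => contDiff_snd.contDiffAt.comp_contMDiffWithinAt (hG x hx)
    have hG2' : ContMDiffOn (𝓡 4) (𝓡 2) ∞ (fun x => vc (invM (toC2 (Q x))).2) (Mk '' D) :=
      contMDiff_ofComplex.comp_contMDiffOn hG2
    have hsymm : ContMDiffOn (𝓡 2) (𝓡 2) ∞ eF.symm univ := by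
      rw [← heFt]; exact contMDiffOn_symm_of_mem_maximalAtlas heF
    refine ContMDiffOn.prodMk ?_ ?_
    · exact hsymm.comp (contMDiff_ofComplex.comp_contMDiffOn hG1) fun _ _ => mem_univ _
    · have hconst : ContMDiffOn (𝓡 4) 𝓘(ℝ, ℝ) ∞ (fun _ : Y => (k⁻¹ : ℝ)) (Mk '' D) :=
        contMDiffOn_const
      exact hconst.smul hG2'
  · rintro ⟨p, w⟩ ⟨hp, hpU⟩
    obtain ⟨h1, -⟩ := toC2_modelPiece hQt hMk p w
    show (eF.symm (vc (invM (toC2 (Q (Mk (p, w))))).1),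
      k⁻¹ • vc (invM (toC2 (Q (Mk (p, w))))).2) = (p, w)
    rw [h1, hleftM _ hpU]
    simp only
    rw [(injOn_A hA).2 p hp]
    congr 1
    have : vc ((k : ℂ) * ⟨w 0, w 1⟩) = k • w := by
      show ((k : ℂ) * ⟨w 0, w 1⟩).re • EuclideanSpace.single (0 : Fin 2) (1 : ℝ) +
        ((k : ℂ) * ⟨w 0, w 1⟩).im • EuclideanSpace.single (1 : Fin 2) (1 : ℝ) = k • w
      rw [← h4b, h2b]
    rw [this, smul_smul, inv_mul_cancel₀ hk.ne', one_smul]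

end Piece

end ModelPiece

end Literature.Topology.FourManifolds
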